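import Summits.BirchSwinnertonDyer.BirchSwinnertonDyer.Theorems.ThetaPartnerAtTwoSignedKatoUpToAtTwoKatoBKSocketHelpers
import HarnessLib

/-!
# Route `ThetaPartnerAtTwo` (TP2), crux K3 `SignedKatoDivisibilityUpToAtTwo` (stmt-BirchSwinnertonDyer-20308 / K3P′ 25631), line `colemanrat`
# v14.1 — Λ-FREE TWINS II: brick B2 (Kato's even primitive character values transported to `F_{2^{n+2}}`) from the VALUE LAW (C5) ALONE,
# and the shape check «the displayed `hC5` IS conjunct (C5) of `ZetaBody`»

Width seat `bsd-wall-tp2-p2x-w2` g8 (cell `bsd-wall`).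

* §1 `KatoValue.charSumF_mul_gaussSum_eq_of_valueLaw` — twin of w4 g0's `KatoValue.charSumF_mul_gaussSum_eq` (`…KatoValueTransfer`): no classes
  `z`, no `Λ`, no Tate-module binders.
* §2 `KatoBK.charSumF_mul_gaussSum_eq_two_of_valueLaw` — twin of the lead's `KatoBK.charSumF_mul_gaussSum_eq_two` (`…KatoBKSocketHelpers`), the
  (B2) input of the socket's level identity at level `2^{n+2}`.
* §3 `KatoValue.valueLaw_of_zetaBody` — a `ZetaBody` witness yields the displayed `hC5` by projection (`hbody.2.2.2.2.2`), so every Λ-free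
  twin specialises back to its original.

AUDIT behind this file (of w3 g8's socket `KatoBK.corePairChiPrim_of_coreKZ_of_bricks`, p636266 = the lead's p635470 re-cut): of the six conjuncts
of `Kato2004.ZetaBody W 2 f ιC κK ΛK c d a A z x` the socket consumes (C1) and (C2) (through `Kato2004.exists_isEulerSystemClassTwo_of_zetaBody`)
and (C5) (through `KatoConst.exists_ratCast_eq_katoConstant_of_analyticRank_eq_zero` — whose call of `zetaBody_value_level_one` DISCARDS the
`Λ`-clause —, `KatoBK.charSumF_mul_gaussSum_eq_two` = w4 g0's `KatoValue.charSumF_mul_gaussSum_eq`, and brick B4c = w4 g0's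
`KatoValue.sum_sigma_eq_of_zetaBody`), never (C3a) (`Λ` Galois-equivariant), (C3b) (`Λ` local at `p`) or (C4) (`Λ(z) = 1 ⊗ x`). So Kato's
ABSTRACT dual-exponential datum `Λ` — whose axioms (C3a)/(C3b) are READINGS of Kato §9.4 carried «with their own attribution» inside the fact
shape (module docstring of `Literature/…/Kato2004/EulerSystemValues.lean`, O1 / X1-eq / X1-loc) — is IDLE in the displayed residue CORE_KZ once
the Bloch–Kato clause (KZ) ties `x` to `z` through the layer pairing. The three files `…KatoBKLambdaFree{Values,CharValues,ESClass}.lean`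
supply the Λ-free inputs of a re-cut socket over CORE_KZ⁰ (= CORE_KZ with «∃ ΛK … ZetaBody … ∧ (KZ)» replaced by «(C1) ∧ (C2) ∧ (C5) ∧ (KZ)»).
The displayed hypothesis `hC5` is VERBATIM conjunct (C5) of `ZetaBody` with its `let` expanded (definitional check:
`KatoValue.valueLaw_of_zetaBody` in `…LambdaFreeCharValues`). Proofs are the originals' proofs with the destructuring of `hbody` removed.
HONEST FRAMING: theorems only (no definition, no named fact, no instance, no `sorry`); every statement is CONDITIONAL on displayed Kato-shaped
hypotheses (conjuncts of the conclusion of the cite-only fact `Kato2004.exists_eulerSystem_expStar_values`); closes no item; K3 / K3P′ are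
NOT settled and BSD is NOT proved by any of this.

References: K. Kato, Astérisque 295 (2004), Ex. 13.3 (p. 225), (8.1.3) (p. 180), Lemma 8.5 (pp. 183–184), §6.2 (p. 161), Thm. 6.6 (1)
(p. 163), Thm. 9.7 (p. 189), §13.1 and Thm. 13.4 (pp. 224–226) [Kato2004Asterisque]; B. Mazur, J. Tate, J. Teitelbaum, Invent. Math. 84
(1986) §I.8 [MazurTateTeitelbaum1986Invent]; L. Washington, *Introduction to Cyclotomic Fields* (1997) §13.1 [Washington1997].
-/

set_option autoImplicit false
-- the Theorems namespace of this sub repeats the summit name by design (D-0017 nested layout)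
set_option linter.dupNamespace false

noncomputable section

set_option backward.isDefEq.respectTransparency false

open scoped BigOperators NumberField TensorProduct MatrixGroups Real

open CongruenceSubgroup Complex WeierstrassCurve Field IsDedekindDomain NumberField
  Literature.NumberTheory.GaloisRepresentations
  Literature.NumberTheory.EllipticCurves Literature.NumberTheory.EllipticCurves.ModularForms
  Literature.NumberTheory.EllipticCurves.Rank1Residual
  Literature.NumberTheory.EllipticCurves.Kato2004 Literature.NumberTheory.EllipticCurves.Kato2004.EulerSystemValues
  Rat.HeightOneSpectrum

namespace Summit.BirchSwinnertonDyer.BirchSwinnertonDyer.Theorems.SignedKatoOffTwo.KatoValue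

variable {W : WeierstrassCurve ℚ} [W.IsElliptic] {N : ℕ} [NeZero N] {f : CuspForm (Gamma0 N) 2}

/-! ## §1 Brick B2 (even primitive character values in `F_{p^k}`) — from (C5) alone -/

omit [W.IsElliptic] in
/-- **VALUE TRANSFER `ℂ → F_{p^k}` from (C5) alone** (Kato (C5) × Birch, even primitive characters): for Kato-shaped values `x` with the value
law (C5) at constant `κ = q ∈ ℚ`, `A = p^e`, `k ≥ 1`, `(cd, p^k·A) = 1`, `dd′ ≡ 1 (mod A)`, and the level-`p^k` embedding normalised
`ι_{p^k}(ζ) = e^{2πi/p^k}`: for every EVEN PRIMITIVE `F`-valued character `ψ` mod `p^k` (`F = ℚ(ζ_{p^k})`),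
`(Σ_b ψ⁻¹(b)·σ_b(x_{k,∅})) · τ_F(ψ) = q · ratTwistedSymbolSum f ψ · R⁻_F(ψ)` in `F`. Twin of w4 g0's `charSumF_mul_gaussSum_eq` (same proof;
no classes, no `Λ`, no Tate-module binders). CONDITIONAL on the displayed (C5).
[cite: Kato2004Asterisque, Thm. 6.6 (1) (p. 163), Thm. 9.7 (p. 189), §6.2 (p. 161)] [cite: MazurTateTeitelbaum1986Invent, §I.8 (8.6)] -/
theorem charSumF_mul_gaussSum_eq_of_valueLaw (hf : IsNewformOf W f) (p : ℕ) [Fact p.Prime]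
    {ι : (m : ℕ) → (CyclotomicField m ℚ →+* ℂ)} {κ : ℝ} {c d a : ℤ} {A : ℕ}
    {x : ∀ (k : ℕ) (r : (cyclotomicLevelsRat p (badPlaces c d A N)).Ideals), CyclotomicField (cycLevel p k r.1) ℚ}
    (hC5 :
      ∀ (k : ℕ) (r : (cyclotomicLevelsRat p (badPlaces c d A N)).Ideals) (d' : ℤ) (χ : DirichletCharacter ℂ (cycLevel p k r.1)) (Lχ : ℂ → ℂ),
        Int.gcd (c * d) (cycLevel p k r.1 * A) = 1 →
        d * d' ≡ 1 [ZMOD (A : ℤ)] →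
        IsDepletedTwistedL f (cycLevel p k r.1) (p * A) χ Lχ →
          (χ (-1) = 1 →
            charSum (cycLevel p k r.1) (ι (cycLevel p k r.1)) χ (x k r) =
              (κ : ℂ) * (Lχ 1 / (plusPeriod f : ℂ)) *
                cuspFactor f true (fun n ↦ χ⁻¹ (n : ZMod (cycLevel p k r.1))) c d a A d') ∧
          (χ (-1) = -1 →
            charSum (cycLevel p k r.1) (ι (cycLevel p k r.1)) χ (x k r) =
              -(κ : ℂ) * (Lχ 1 / (Complex.I * (minusPeriod f : ℂ))) *
                cuspFactor f false (fun n ↦ χ⁻¹ (n : ZMod (cycLevel p k r.1))) c d a A d'))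
    {q : ℚ} (hκ : κ = q) {k e : ℕ} (hk : 1 ≤ k) (hA : A = p ^ e) (d' : ℤ)
    (hcd : Int.gcd (c * d) (cycLevel p k (∅ : Finset (HeightOneSpectrum (𝓞 ℚ))) * A) = 1)
    (hdd' : d * d' ≡ 1 [ZMOD (A : ℤ)])
    (hι : ι (cycLevel p k (∅ : Finset (HeightOneSpectrum (𝓞 ℚ))))
        (IsCyclotomicExtension.zeta (cycLevel p k (∅ : Finset (HeightOneSpectrum (𝓞 ℚ)))) ℚ
          (CyclotomicField (cycLevel p k (∅ : Finset (HeightOneSpectrum (𝓞 ℚ)))) ℚ)) =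
      Complex.exp (2 * π * I / (cycLevel p k (∅ : Finset (HeightOneSpectrum (𝓞 ℚ))) : ℕ)))
    (ψ : DirichletCharacter (CyclotomicField (cycLevel p k (∅ : Finset (HeightOneSpectrum (𝓞 ℚ)))) ℚ)
      (cycLevel p k (∅ : Finset (HeightOneSpectrum (𝓞 ℚ)))))
    (hψ : ψ.IsPrimitive) (hev : ψ.Even) :
    (∑ b : (ZMod (cycLevel p k (∅ : Finset (HeightOneSpectrum (𝓞 ℚ)))))ˣ,
        ψ⁻¹ (b : ZMod _) * sigma (cycLevel p k (∅ : Finset (HeightOneSpectrum (𝓞 ℚ)))) b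
          (x k (cyclotomicLevelsRat p (badPlaces c d A N)).idealOne)) *
      gaussSum ψ (AddChar.zmodChar (cycLevel p k (∅ : Finset (HeightOneSpectrum (𝓞 ℚ))))
        (IsCyclotomicExtension.zeta_spec (cycLevel p k (∅ : Finset (HeightOneSpectrum (𝓞 ℚ)))) ℚ
          (CyclotomicField (cycLevel p k (∅ : Finset (HeightOneSpectrum (𝓞 ℚ)))) ℚ)).pow_eq_one) =
    (q : CyclotomicField (cycLevel p k (∅ : Finset (HeightOneSpectrum (𝓞 ℚ)))) ℚ) * ratTwistedSymbolSum f ψ *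
      (((c : CyclotomicField (cycLevel p k ∅) ℚ) ^ 2 * (d : CyclotomicField (cycLevel p k ∅) ℚ) ^ 2) *
            ((ratMinusSymbol f ((a : ℚ) / A) : ℚ) : CyclotomicField (cycLevel p k ∅) ℚ) -
          ((c : CyclotomicField (cycLevel p k ∅) ℚ) * (d : CyclotomicField (cycLevel p k ∅) ℚ) ^ 2) *
            ψ ((c : ℤ) : ZMod _) *
            ((ratMinusSymbol f ((a * c : ℚ) / A) : ℚ) : CyclotomicField (cycLevel p k ∅) ℚ) -
          ((c : CyclotomicField (cycLevel p k ∅) ℚ) ^ 2 * (d : CyclotomicField (cycLevel p k ∅) ℚ)) *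
            ψ ((d : ℤ) : ZMod _) *
            ((ratMinusSymbol f ((a * d' : ℚ) / A) : ℚ) : CyclotomicField (cycLevel p k ∅) ℚ) +
          ((c : CyclotomicField (cycLevel p k ∅) ℚ) * (d : CyclotomicField (cycLevel p k ∅) ℚ)) *
            ψ ((c * d : ℤ) : ZMod _) *
            ((ratMinusSymbol f ((a * c * d' : ℚ) / A) : ℚ) : CyclotomicField (cycLevel p k ∅) ℚ)) := by
  have hp : p.Prime := Fact.out
  have hm : cycLevel p k (∅ : Finset (HeightOneSpectrum (𝓞 ℚ))) = p ^ k := by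
    rw [cycLevel, Finset.prod_empty, mul_one]
  -- the complex characters: `χ := ψ⁻¹_ℂ` (Kato's), `ψ_ℂ := ψ.ringHomComp ι` (Birch's), `ψ_ℂ⁻¹ = χ`
  set ψC : DirichletCharacter ℂ (cycLevel p k (∅ : Finset (HeightOneSpectrum (𝓞 ℚ)))) :=
    ψ.ringHomComp (ι (cycLevel p k (∅ : Finset (HeightOneSpectrum (𝓞 ℚ))))) with hψC
  set χ : DirichletCharacter ℂ (cycLevel p k (∅ : Finset (HeightOneSpectrum (𝓞 ℚ)))) :=
    ψ⁻¹.ringHomComp (ι (cycLevel p k (∅ : Finset (HeightOneSpectrum (𝓞 ℚ))))) with hχ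
  have hχinv : ψC⁻¹ = χ := by rw [hψC, hχ, MulChar.ringHomComp_inv]
  have hψCprim : ψC.IsPrimitive := (isPrimitive_ringHomComp_iff _ ψ).mpr hψ
  have hψCeven : ψC.Even := (even_ringHomComp_iff _ ψ).mpr hev
  have hχeven : χ (-1) = 1 := by
    have h1 : ψC (-1) = 1 := hψCeven
    rw [← hχinv, MulChar.inv_apply_eq_inv, h1, Ring.inverse_one]
  -- the continuation of `L(f, χ, s)` (no depletion at `S = {p}`)
  obtain ⟨L₀, hL₀d, hL₀s⟩ := exists_differentiable_eq_twistedLSeries_holds f χ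
  have hdep : IsDepletedTwistedL f (cycLevel p k (∅ : Finset (HeightOneSpectrum (𝓞 ℚ)))) (p * A) χ L₀ :=
    isDepletedTwistedL_of_prime_pow hf.1 p hk hm hA χ hL₀d hL₀s
  -- Kato (C5), even clause
  have hK : charSum (cycLevel p k (∅ : Finset (HeightOneSpectrum (𝓞 ℚ)))) (ι (cycLevel p k (∅ : Finset (HeightOneSpectrum (𝓞 ℚ)))))
      χ (x k (cyclotomicLevelsRat p (badPlaces c d A N)).idealOne) =
      κ * (L₀ 1 / (plusPeriod f : ℂ)) *
        cuspFactor f true (fun n ↦ χ⁻¹ (n : ZMod (cycLevel p k (∅ : Finset (HeightOneSpectrum (𝓞 ℚ)))))) c d a A d' :=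
    (hC5 k (cyclotomicLevelsRat p (badPlaces c d A N)).idealOne d' χ L₀ hcd hdd' hdep).1 hχeven
  -- Birch at `ψ_ℂ`
  have hB := ratTwistedSymbolSum_mul_plusPeriod_holds (f := f) hf.1 hf.coeffField_eq_bot hψCprim hψCeven hL₀d
    (fun s hs ↦ by rw [hχinv]; exact hL₀s s hs)
  -- everything is an `ι`-image
  have hΩ : (plusPeriod f : ℂ) ≠ 0 := by
    exact_mod_cast (IsNewform0.plusPeriod_pos_holds hf.1 hf.coeffField_eq_bot).ne'
  have hcs := map_charSumF (ι (cycLevel p k (∅ : Finset (HeightOneSpectrum (𝓞 ℚ))))) ψ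
    (x k (cyclotomicLevelsRat p (badPlaces c d A N)).idealOne)
  have hgs := map_gaussSum_zmodChar (ι (cycLevel p k (∅ : Finset (HeightOneSpectrum (𝓞 ℚ))))) hι ψ
  have hcf := map_cuspFactorF (ι (cycLevel p k (∅ : Finset (HeightOneSpectrum (𝓞 ℚ))))) f ψ c d a A d'
  have hrt : ratTwistedSymbolSum f ψC = ι (cycLevel p k (∅ : Finset (HeightOneSpectrum (𝓞 ℚ)))) (ratTwistedSymbolSum f ψ) :=
    ratTwistedSymbolSum_ringHomComp _ f ψ
  apply (ι (cycLevel p k (∅ : Finset (HeightOneSpectrum (𝓞 ℚ))))).injective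
  rw [map_mul, hcs, hgs, map_mul, map_mul, hcf, map_ratCast, ← hrt, hK, hκ]
  -- `κ·(L₀(1)/Ω⁺)·R · τ = q · RTSS · R` from Birch `RTSS·Ω⁺ = τ·L₀(1)`
  have hB' : ratTwistedSymbolSum f ψC =
      gaussSum ψC (ZMod.stdAddChar (N := cycLevel p k (∅ : Finset (HeightOneSpectrum (𝓞 ℚ))))) * L₀ 1 / (plusPeriod f : ℂ) := by
    rw [eq_div_iff hΩ, hB]
  rw [hB']
  push_cast
  field_simp
  ring

end Summit.BirchSwinnertonDyer.BirchSwinnertonDyer.Theorems.SignedKatoOffTwo.KatoValue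

namespace Summit.BirchSwinnertonDyer.BirchSwinnertonDyer.Theorems.SignedKatoOffTwo.KatoBK

/-! ## §2 The socket-shaped brick B2 over (C5) alone (level `2^{n+2}`) -/

/-- **(B2) at level `2^{n+2}` in the shape of the level identity, from (C5) alone** (twin of `charSumF_mul_gaussSum_eq_two`: the gcd side
condition discharged for odd `c, d`, and `ψ(cd) = ψ(c)ψ(d)`). [cite: Kato2004Asterisque, Thm. 6.6 (1), Thm. 9.7] -/
theorem charSumF_mul_gaussSum_eq_two_of_valueLaw {W : WeierstrassCurve ℚ} [W.IsElliptic] {N : ℕ} [NeZero N] {f : CuspForm (Gamma0 N) 2}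
    (hf : IsNewformOf W f) {ιC : (m : ℕ) → (CyclotomicField m ℚ →+* ℂ)} {κK : ℝ} {c dd a : ℤ} {ee : ℕ}
    {x : ∀ (k : ℕ) (r : (cyclotomicLevelsRat 2 (badPlaces c dd (2 ^ ee) N)).Ideals), CyclotomicField (cycLevel 2 k r.1) ℚ}
    (hC5 :
      ∀ (k : ℕ) (r : (cyclotomicLevelsRat 2 (badPlaces c dd (2 ^ ee) N)).Ideals) (d' : ℤ) (χ : DirichletCharacter ℂ (cycLevel 2 k r.1)) (Lχ : ℂ → ℂ),
        Int.gcd (c * dd) (cycLevel 2 k r.1 * (2 ^ ee)) = 1 →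
        dd * d' ≡ 1 [ZMOD ((2 ^ ee) : ℤ)] →
        IsDepletedTwistedL f (cycLevel 2 k r.1) (2 * (2 ^ ee)) χ Lχ →
          (χ (-1) = 1 →
            charSum (cycLevel 2 k r.1) (ιC (cycLevel 2 k r.1)) χ (x k r) =
              (κK : ℂ) * (Lχ 1 / (plusPeriod f : ℂ)) *
                cuspFactor f true (fun n ↦ χ⁻¹ (n : ZMod (cycLevel 2 k r.1))) c dd a (2 ^ ee) d') ∧
          (χ (-1) = -1 →
            charSum (cycLevel 2 k r.1) (ιC (cycLevel 2 k r.1)) χ (x k r) =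
              -(κK : ℂ) * (Lχ 1 / (Complex.I * (minusPeriod f : ℂ))) *
                cuspFactor f false (fun n ↦ χ⁻¹ (n : ZMod (cycLevel 2 k r.1))) c dd a (2 ^ ee) d'))
    {q : ℚ} (hq : κK = q) (hcodd : ¬ (2 : ℤ) ∣ c) (hdodd : ¬ (2 : ℤ) ∣ dd) (d' : ℤ) (hdd' : dd * d' ≡ 1 [ZMOD ((2 ^ ee : ℕ) : ℤ)])
    {n : ℕ}
    (hιC : ιC (cycLevel 2 (n + 2) (∅ : Finset (HeightOneSpectrum (𝓞 ℚ))))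
        (IsCyclotomicExtension.zeta (cycLevel 2 (n + 2) (∅ : Finset (HeightOneSpectrum (𝓞 ℚ)))) ℚ
          (CyclotomicField (cycLevel 2 (n + 2) (∅ : Finset (HeightOneSpectrum (𝓞 ℚ)))) ℚ)) =
      Complex.exp (2 * Real.pi * Complex.I / (cycLevel 2 (n + 2) (∅ : Finset (HeightOneSpectrum (𝓞 ℚ))) : ℕ))) :
    ∀ ψF : DirichletCharacter (CyclotomicField (cycLevel 2 (n + 2) (∅ : Finset (HeightOneSpectrum (𝓞 ℚ)))) ℚ)
      (cycLevel 2 (n + 2) (∅ : Finset (HeightOneSpectrum (𝓞 ℚ)))), ψF (-1) = 1 → ψF.IsPrimitive →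
      (∑ b : (ZMod (cycLevel 2 (n + 2) (∅ : Finset (HeightOneSpectrum (𝓞 ℚ)))))ˣ,
          ψF⁻¹ (b : ZMod _) * sigma (cycLevel 2 (n + 2) (∅ : Finset (HeightOneSpectrum (𝓞 ℚ)))) b
            (x (n + 2) (cyclotomicLevelsRat 2 (badPlaces c dd (2 ^ ee) N)).idealOne)) *
          gaussSum ψF (AddChar.zmodChar (cycLevel 2 (n + 2) (∅ : Finset (HeightOneSpectrum (𝓞 ℚ))))
            (IsCyclotomicExtension.zeta_pow (cycLevel 2 (n + 2) (∅ : Finset (HeightOneSpectrum (𝓞 ℚ)))) ℚ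
              (CyclotomicField (cycLevel 2 (n + 2) (∅ : Finset (HeightOneSpectrum (𝓞 ℚ)))) ℚ))) =
        (q : CyclotomicField (cycLevel 2 (n + 2) ∅) ℚ) * ratTwistedSymbolSum f ψF *
          ((c : CyclotomicField (cycLevel 2 (n + 2) ∅) ℚ) ^ 2 * (dd : CyclotomicField (cycLevel 2 (n + 2) ∅) ℚ) ^ 2 *
              ((ratMinusSymbol f ((a : ℚ) / (2 ^ ee : ℕ)) : ℚ) : CyclotomicField (cycLevel 2 (n + 2) ∅) ℚ)
            - (c : CyclotomicField (cycLevel 2 (n + 2) ∅) ℚ) * (dd : CyclotomicField (cycLevel 2 (n + 2) ∅) ℚ) ^ 2 *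
              ψF (c : ZMod _) * ((ratMinusSymbol f ((a * c : ℚ) / (2 ^ ee : ℕ)) : ℚ) : CyclotomicField (cycLevel 2 (n + 2) ∅) ℚ)
            - (c : CyclotomicField (cycLevel 2 (n + 2) ∅) ℚ) ^ 2 * (dd : CyclotomicField (cycLevel 2 (n + 2) ∅) ℚ) *
              ψF (dd : ZMod _) * ((ratMinusSymbol f ((a * d' : ℚ) / (2 ^ ee : ℕ)) : ℚ) : CyclotomicField (cycLevel 2 (n + 2) ∅) ℚ)
            + (c : CyclotomicField (cycLevel 2 (n + 2) ∅) ℚ) * (dd : CyclotomicField (cycLevel 2 (n + 2) ∅) ℚ) *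
              (ψF (c : ZMod _) * ψF (dd : ZMod _)) *
              ((ratMinusSymbol f ((a * c * d' : ℚ) / (2 ^ ee : ℕ)) : ℚ) : CyclotomicField (cycLevel 2 (n + 2) ∅) ℚ)) := by
  intro ψF hev hψ
  have h := KatoValue.charSumF_mul_gaussSum_eq_of_valueLaw hf 2 hC5 hq (by omega : 1 ≤ n + 2) rfl d'
    (gcd_mul_cycLevel_mul_pow_eq_one hcodd hdodd (n + 2) ee) hdd' hιC ψF hψ hev
  rw [Int.cast_mul, map_mul] at h
  exact h

end Summit.BirchSwinnertonDyer.BirchSwinnertonDyer.Theorems.SignedKatoOffTwo.KatoBK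

namespace Summit.BirchSwinnertonDyer.BirchSwinnertonDyer.Theorems.SignedKatoOffTwo.KatoValue

/-! ## §3 The displayed value-law hypothesis IS conjunct (C5) of `ZetaBody` -/

/-- **Shape check.** The hypothesis `hC5` displayed throughout this file (Kato's value law, Thm. 9.7 ∘ Thm. 6.6 (1), for the values `x` at
constant `κ` and embeddings `ι`, auxiliary datum `(c, d, a, A)`) is VERBATIM the last conjunct of `Kato2004.ZetaBody W p f ι κ Λ c d a A z x`
(the `let`s expanded): a `ZetaBody` witness yields it by projection. [cite: Kato2004Asterisque, Thm. 6.6 (1) (p. 163), Thm. 9.7 (p. 189)] -/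
theorem valueLaw_of_zetaBody {W : WeierstrassCurve ℚ} [W.IsElliptic] {p : ℕ} [Fact p.Prime]
    [ContinuousSMul ℤ_[p] (W.tateModule p)] [Module.Free ℤ_[p] (W.tateModule p)] [Module.Finite ℤ_[p] (W.tateModule p)]
    {N : ℕ} {f : CuspForm (Gamma0 N) 2} {ι : (m : ℕ) → (CyclotomicField m ℚ →+* ℂ)} {κ : ℝ}
    {Λ : ∀ (k : ℕ) (r : Finset (HeightOneSpectrum (𝓞 ℚ))),
      H1 (tateRep W p) (cycSubgroup p k r) →ₗ[ℤ_[p]] ℚ_[p] ⊗[ℚ] CyclotomicField (cycLevel p k r) ℚ}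
    {c d a : ℤ} {A : ℕ}
    {z : ∀ (k : ℕ) (r : (cyclotomicLevelsRat p (badPlaces c d A N)).Ideals),
      H1 (tateRep W p) ((cyclotomicLevelsRat p (badPlaces c d A N)).level k r.1)}
    {x : ∀ (k : ℕ) (r : (cyclotomicLevelsRat p (badPlaces c d A N)).Ideals), CyclotomicField (cycLevel p k r.1) ℚ}
    (hbody : ZetaBody W p f ι κ Λ c d a A z x) :
    ∀ (k : ℕ) (r : (cyclotomicLevelsRat p (badPlaces c d A N)).Ideals) (d' : ℤ) (χ : DirichletCharacter ℂ (cycLevel p k r.1)) (Lχ : ℂ → ℂ),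
      Int.gcd (c * d) (cycLevel p k r.1 * A) = 1 →
      d * d' ≡ 1 [ZMOD (A : ℤ)] →
      IsDepletedTwistedL f (cycLevel p k r.1) (p * A) χ Lχ →
        (χ (-1) = 1 →
          charSum (cycLevel p k r.1) (ι (cycLevel p k r.1)) χ (x k r) =
            (κ : ℂ) * (Lχ 1 / (plusPeriod f : ℂ)) *
              cuspFactor f true (fun n ↦ χ⁻¹ (n : ZMod (cycLevel p k r.1))) c d a A d') ∧
        (χ (-1) = -1 →
          charSum (cycLevel p k r.1) (ι (cycLevel p k r.1)) χ (x k r) =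
            -(κ : ℂ) * (Lχ 1 / (Complex.I * (minusPeriod f : ℂ))) *
              cuspFactor f false (fun n ↦ χ⁻¹ (n : ZMod (cycLevel p k r.1))) c d a A d') :=
  hbody.2.2.2.2.2

end Summit.BirchSwinnertonDyer.BirchSwinnertonDyer.Theorems.SignedKatoOffTwo.KatoValue

end
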